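import Summits.Schanuel.Schanuel.Theorems.RootDecomp1KSuperellipticSiegel03

/-!
# RootDecomp1KSuperellipticSiegel — lens 1, generation 63, NODE 24 «SUPERELLIPTIC SIEGEL ON THE K-LINE — the lacunary dominant-far sector» (the superelliptic Siegel–LeVeque theorem y^m = f(x), m ≥ 3, f with two simple roots, over any number field — PROVED from the tree's unit equation via the cyclotomic–Kummer tower and Siegel's identity; the engine on DOMINANT LACUNARY pairs c_k(Y)·x^k + c₀(Y), k ≥ 3 ⇒ SiegelClause / LevelFinite / ThinFibreAt ∀ m₀ / BddLevelEmpty, intrinsically the class DomSuper P; the genus-six family T j := x³ − (Y⁷ + (4j+2)Y − (4j+2)) decided hypothesis-free ∀ j ∈ ℤ; the territory T_territory incl. 2-adic liveness by size at m₀ = 2; CLAIM L2927, PRICE L2930, K-R55) — continuation (RootDecomp1KSuperellipticSiegel04): §F the family A j / tC / T j with T_eq_twoTermP, the uniform 2-Eisenstein certificate, domSuper_T and the currencies (section Family)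

(lens-1 g63 NODE 24 «SUPERELLIPTIC SIEGEL ON THE K-LINE — the LACUNARY DOMINANT-FAR SECTOR» L2940/L2941: HOME kernel K = HOME/decomp-schanuel-lens-1/g63/lean/SuperellipticSiegel.lean sha256 f78e5b9a…, 1410 l, ONE namespace `Summit.Schanuel.Schanuel.Theorems.RootDecomp1KSuperellipticSiegel`, imports the tree port …RootDecomp1KHyperellipticSiegel05 ONLY (node 23's part 01 carries the PROVED Literature modules SiegelCubicReduction / UnitEquationFinite / SIntegersFiniteExtension; no …Proofs umbrella, no fact file); no private, no instance, no set_option, no notation, no sorry, no decide; CLAIM L2927, census LIVENESS-v29 (rows T 0 / T 17 tabled on request, OF RECORD L2931 with the critic's territory certificate; keys domSuper / ladder / superell / galtop), crit g12 PRICE L2930 (PAYABLE THEOREM ×1 EX ANTE for (L)+(E)+(F)+(T) jointly under RULE K-R54 (iii) — the superelliptic grade, the LAST credit on the integral-points lane; CHECKLIST K-g63 (1)–(11); RULE K-R55 PRE-ANNOUNCED), writer g33 NOTE 8 L2928 (pre-check 16/16), critic VERDICT: CLEARED — THEOREM ×1 for (L)+(E)+(F)+(T) JOINTLY, ONE credit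 (RULE K-R54 (iii), the superelliptic grade — the LAST credit on the integral-points lane), VERDICT L2943 (crit-1 g12, 2026-09-01T23:12Z): CHECKLIST K-g63 (1)–(11) met item by item on the critic's own farm runs (K rc 0 · 0 errors · 0 sorries; Probe rc 0 with 253 `#print axioms` guards ⊆ the standard triple; Ctrl0 rc 0; Ctrl rc 1 = exactly the 53 planted errors; L_standalone rc 0 ⇒ §L is K-line-independent modulo node 23's Literature-only part 01); TALLY lens-1 ×21 + THEOREM ×23; RULE K-R55 FIXED ((i) toolkit ∪= superelliptic integral-point Siegel — THE INTEGRAL-POINTS LANE IS CLOSED; (ii) open territory at m₀ = 2 := K-R54 (ii) territory not reached by (i): NON-DOMINANT (standing witness W4) and DOMINANT-FAR NON-LACUNARY (standing witness X3); (iii) payable clause; (iv) unconditional part ∪= the node-24 tree names after the port); PORT GO L2944 exactly as census STAGING NOTE 15 L2942 (six parts; the two docstring-preserving boundary moves approved; no privatisation). Port by census-1 gen 24 per NODE-g63.md §(11) as `RootDecomp1KSuperellipticSiegel01–06` (`--supports stmt-Schanuel-33364`; the item stays OPEN; no census credit): 01 = §L floors (section Local: the m-divisibility lemma `natCast_dvd_log_map_sub_of_pow_eq_mul_prod`,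 Siegel's factors / identity / ratio `geomSum_mul_sub_eq` / `map_sub_mul_eq_one` / `siegel_identity_pow` / `eq_of_ratio`; the cyclotomic + Kummer tower `exists_numberField_forall_mem_selmerGroup_isPow` / `exists_numberField_forall_isPow_of_dvd`; bad places `exists_finite_places`); 02 = §L main theorem `finite_integer_pow_eq_of_unitEquation` (U-binder verbatim as the tree's cubic case) + `finite_integer_pow_eq` (unconditional by `finite_unitEquation`) + `finite_integer_pow_eq_of_separable`; 03 = §E the engine on dominant LACUNARY pairs of x-degree k ≥ 3 (the `_lac` chain over node 23's `den_dvd_of_dyadic`, `def DomSuper`, `domSuper_xPolyP_iff` / `domSuper_twoTermP_iff`, the doors `siegelClause_of_domSuper` / `levelFinite_of_domSuper` / `thinFibreAt_of_domSuper` / `bddLevelEmpty_of_domSuper`, disjointness `not_domHyper_of_domSuper` / `not_domSuper_*`) (section Engine); 04 = §F the family `A j`, `tC`, `T j` (`T_eq_twoTermP`), `isEisensteinAt_A` ⇒ `domSuper_T` ⇒ `levelFinite_T` / `thinFibreAt_T` / `siegelClause_T` / … (section Family); 05 = §T part 1 (coefficient read-backs, shape refusals, the deciders' negations, GaussAt 3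 and the ladder at 3, the anchor (1, 1), the odd-prime sieves refused, real liveness) (section Territory, to be continued); 06 = §T part 2 ((T-2) `den_pow_seven_le_T` / `den_pow_lt_T` / `not_thin_ineq_two_T`, `thinFibreAt_two_iff_levelFinite_T`, `T_territory`, `T'` with `T'_zero` / `T'_one` / `T'_territory`) (section Territory re-opened with K's own open-lines). Literature / node-23 twins are CITED by name, never restated. Text = K VERBATIM (every declaration documented by the lens; statements and proofs unchanged; K's module docstring kept in part 01 below this provenance block).)
-/

noncomputable section

namespace Summit.Schanuel.Schanuel.Theorems.RootDecomp1KSuperellipticSiegel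

open Polynomial IsDedekindDomain NumberField
open scoped Classical WithZero
open Literature.NumberTheory.DiophantineGeometry (finite_unitEquation exists_finite_forall_mem_integer_algebraMap
  valuation_algebraMap_eq_one_of_mem_integer_inv valuation_eq_one_of_mul_eq_one)
open IsDedekindDomain.HeightOneSpectrum (setOf_valuation_ne_one_finite setOf_one_lt_valuation_finite)
open Summit.Schanuel.Schanuel.Theorems.RootDecomp1KHyperellipticSiegel (setOf_ne_and_valuation_sub_ne_one_finite)

/-! ### §F  THE INFINITE FAMILY `T j := x³ − A_j(Y)`, `A_j := Y⁷ + (4j+2)·Y − (4j+2)`, `j ∈ ℤ` — EVERY MEMBER IN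
`DomSuper` BY ONE UNIFORM CERTIFICATE (`A_j` is 2-EISENSTEIN: irreducible, hence separable, of degree 7; `c₃ = 1`) -/

section Family

open LiouvilleNumber
open scoped Nat
open Summit.Schanuel.Schanuel.Theorems.RootDecomp1KDegreeLadder
open Summit.Schanuel.Schanuel.Theorems.RootDecomp1KXTop
open Summit.Schanuel.Schanuel.Theorems.RootDecomp1KXAll
open Summit.Schanuel.Schanuel.Theorems.RootDecomp1KLevelFinite
open Summit.Schanuel.Schanuel.Theorems.RootDecomp1KIntegrality (DomZero)
open Summit.Schanuel.Schanuel.Theorems.RootDecomp1KHeightGrading (BddLevelEmpty bddLevelEmpty_iff_levelFinite)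

/-- [datum] `A_j := Y⁷ + (4j + 2)·Y − (4j + 2) ∈ ℤ[Y]` — 2-EISENSTEIN for EVERY `j ∈ ℤ` (`2 ∣ 4j+2`, `4 ∤ 4j+2`), with
`A_j(1) = 1 = 1³` (the anchor point `(1, 1)` of `T j`). -/
def A (j : ℤ) : ℤ[X] := X ^ 7 + C (4 * j + 2) * X - C (4 * j + 2)
/-- [datum] the `x`-coefficients of `T j`: `c₃ = 1`, `c₀ = −A_j`, all others `0` (LACUNARY). -/
def tC (j : ℤ) : ℕ → ℤ[X] := twoTermC 3 1 (A j)
/-- [datum] **THE FAMILY `T j := x³ − A_j(Y) = x³ − (Y⁷ + (4j+2)Y − (4j+2))`**, `j ∈ ℤ` (CLAIM L2927). -/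
def T (j : ℤ) : ℤ[X][X] := xPolyP 3 (tC j)

/-- `(j : ℤ) : tC j 3 = 1`. -/
@[simp] theorem tC_three (j : ℤ) : tC j 3 = 1 := by simp [tC]
/-- `(j : ℤ) : tC j 0 = -A j`. -/
@[simp] theorem tC_zero (j : ℤ) : tC j 0 = -A j := by simp [tC, twoTermC]
/-- `(j : ℤ) {i : ℕ} (h3 : i ≠ 3) (h0 : i ≠ 0) : tC j i = 0`. -/
theorem tC_of_ne (j : ℤ) {i : ℕ} (h3 : i ≠ 3) (h0 : i ≠ 0) : tC j i = 0 := by simp [tC, twoTermC, h3, h0]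
/-- `(j : ℤ) : tC j 3 ≠ 0`. -/
theorem tC_three_ne_zero (j : ℤ) : tC j 3 ≠ 0 := by rw [tC_three]; exact one_ne_zero
/-- LACUNARITY of the presentation: `tC j 1 = tC j 2 = 0`. -/
theorem tC_lac (j : ℤ) : ∀ i, 1 ≤ i → i < 3 → tC j i = 0 := fun i h1 h3 => tC_of_ne j (by omega) (by omega)

/-- **`T j` IS THE TWO-TERM CURVE `x³·1 − A_j(Y)`** (node 13½'s `twoTermP 3 1 (A j)`), an identity of polynomials. -/
theorem T_eq_twoTermP (j : ℤ) : T j = twoTermP 3 1 (A j) := (twoTermP_eq_xPolyP (by norm_num) 1 (A j)).symm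

/-- `(j : ℤ) : (A j).natDegree = 7`. -/
theorem natDegree_A (j : ℤ) : (A j).natDegree = 7 := by unfold A; compute_degree!
/-- `(j : ℤ) : (A j).coeff 7 = 1`. -/
theorem coeff_A_seven (j : ℤ) : (A j).coeff 7 = 1 := by
  rw [A]; simp only [coeff_sub, coeff_add, coeff_X_pow, coeff_C_mul_X, coeff_C]; norm_num
/-- `(j : ℤ) : (A j).coeff 1 = 4 * j + 2`. -/
theorem coeff_A_one (j : ℤ) : (A j).coeff 1 = 4 * j + 2 := by
  rw [A]; simp only [coeff_sub, coeff_add, coeff_X_pow, coeff_C_mul_X, coeff_C]; norm_num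
/-- `(j : ℤ) : (A j).coeff 0 = -(4 * j + 2)`. -/
theorem coeff_A_zero (j : ℤ) : (A j).coeff 0 = -(4 * j + 2) := by
  rw [A]; simp only [coeff_sub, coeff_add, coeff_X_pow, coeff_C_mul_X, coeff_C]; norm_num
/-- `(j : ℤ) {n : ℕ} (h1 : 1 < n) (h7 : n < 7) : (A j).coeff n = 0`. -/
theorem coeff_A_of_lt (j : ℤ) {n : ℕ} (h1 : 1 < n) (h7 : n < 7) : (A j).coeff n = 0 := by
  rw [A]; simp only [coeff_sub, coeff_add, coeff_X_pow, coeff_C_mul_X, coeff_C]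
  rw [if_neg (by omega), if_neg (by omega), if_neg (by omega)]; ring
/-- `(j : ℤ) : (A j).leadingCoeff = 1`. -/
theorem leadingCoeff_A (j : ℤ) : (A j).leadingCoeff = 1 := by rw [leadingCoeff, natDegree_A, coeff_A_seven]
/-- `(j : ℤ) : (A j).Monic`. -/
theorem monic_A (j : ℤ) : (A j).Monic := leadingCoeff_A j
/-- `{R} [CommRing R] [Algebra ℤ R] (j : ℤ) (y : R) : aeval y (A j) = y ^ 7 + (4j + 2)·y − (4j + 2)`. -/
@[simp] theorem aeval_A {R : Type*} [CommRing R] [Algebra ℤ R] (j : ℤ) (y : R) :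
    aeval y (A j) = y ^ 7 + (4 * (j : R) + 2) * y - (4 * (j : R) + 2) := by
  simp [A, map_ofNat]

/-- **`A_j` IS 2-EISENSTEIN FOR EVERY `j ∈ ℤ`** (`2 ∤ 1`; `2 ∣ −(4j+2), 4j+2, 0, 0, 0, 0, 0`; `4 ∤ −(4j+2)`) — the UNIFORM
SEPARABILITY CERTIFICATE of the family (pattern of node 23's `isEisensteinAt_mD`, prime `2` instead of `3`). -/
theorem isEisensteinAt_A (j : ℤ) : (A j).IsEisensteinAt (Ideal.span {(2 : ℤ)}) := by
  refine ⟨?_, fun {n} hn => ?_, ?_⟩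
  · rw [leadingCoeff_A, Ideal.mem_span_singleton]; omega
  · rw [natDegree_A] at hn
    rw [Ideal.mem_span_singleton]
    rcases Nat.lt_or_ge n 2 with h2 | h2
    · interval_cases n
      · rw [coeff_A_zero]; exact ⟨-(2 * j + 1), by ring⟩
      · rw [coeff_A_one]; exact ⟨2 * j + 1, by ring⟩
    · rw [coeff_A_of_lt j (by omega) hn]; exact dvd_zero 2
  · rw [Ideal.span_singleton_pow, Ideal.mem_span_singleton, coeff_A_zero]; omega
/-- **`A_j` is IRREDUCIBLE in `ℤ[Y]`** for every `j` (Eisenstein at `2`, monic hence primitive) … -/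
theorem irreducible_A (j : ℤ) : Irreducible (A j) :=
  (isEisensteinAt_A j).irreducible ((Ideal.span_singleton_prime (by norm_num)).mpr
    (Int.prime_iff_natAbs_prime.mpr (by norm_num))) (monic_A j).isPrimitive (by rw [natDegree_A]; norm_num)
/-- **… hence IRREDUCIBLE OVER `ℚ`** (Gauss) … -/
theorem irreducible_A_rat (j : ℤ) : Irreducible ((A j).map (Int.castRingHom ℚ)) :=
  (IsPrimitive.Int.irreducible_iff_irreducible_map_cast (monic_A j).isPrimitive).mp (irreducible_A j)
/-- **… hence SEPARABLE over `ℚ`**: `y³ = A_j(Y)` is a smooth affine SUPERELLIPTIC curve of GENUS SIX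
(`(3−1)(7−1)/2`), uniformly in `j`. -/
theorem separable_A_rat (j : ℤ) : ((A j).map (Int.castRingHom ℚ)).Separable := (irreducible_A_rat j).separable
/-- `(j : ℤ) : 2 ≤ (A j).natDegree`. -/
theorem two_le_natDegree_A (j : ℤ) : 2 ≤ (A j).natDegree := by rw [natDegree_A]; norm_num

/-- **DOMINANCE**: `deg c₁ = deg c₂ = deg 0 = 0 < 7`, `deg c₃ = deg 1 = 0 < 7` — `DomZero 3 (tC j)` for every `j`. -/
theorem domZero_tC (j : ℤ) : DomZero 3 (tC j) := by
  intro i hi1 hi3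
  rw [tC_zero, natDegree_neg, natDegree_A]
  interval_cases i
  · rw [tC_of_ne j (by norm_num) (by norm_num), natDegree_zero]; norm_num
  · rw [tC_of_ne j (by norm_num) (by norm_num), natDegree_zero]; norm_num
  · rw [tC_three, natDegree_one]; norm_num
/-- the engine's separability hypothesis for `T j`, uniformly in `j` (2-Eisenstein). -/
theorem separable_tC_zero (j : ℤ) : ((tC j 0).map (Int.castRingHom ℚ)).Separable := by
  rw [tC_zero, Polynomial.map_neg]
  exact (separable_A_rat j).of_dvd (neg_dvd.mpr dvd_rfl)
/-- the engine's degree hypothesis for `T j`. -/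
theorem two_le_natDegree_tC_zero (j : ℤ) : 2 ≤ (tC j 0).natDegree := by
  rw [tC_zero, natDegree_neg]; exact two_le_natDegree_A j
/-- the engine's coprimality hypothesis for `T j` (`c₃ = 1`). -/
theorem isCoprime_tC (j : ℤ) : IsCoprime ((tC j 0).map (Int.castRingHom ℚ)) ((tC j 3).map (Int.castRingHom ℚ)) := by
  rw [tC_three, Polynomial.map_one]; exact isCoprime_one_right
/-- **`T j ∈ DomSuper` for every `j ∈ ℤ`** — the class membership, by the uniform certificate. -/
theorem domSuper_T (j : ℤ) : DomSuper (T j) :=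
  (domSuper_xPolyP_iff 3 (tC j) (tC_three_ne_zero j)).mpr
    ⟨le_rfl, tC_lac j, domZero_tC j, separable_tC_zero j, two_le_natDegree_tC_zero j, isCoprime_tC j⟩

/-- **`∀ j, LevelFinite (T j)`** — HYPOTHESIS-FREE (the superelliptic Siegel theorem for `y³ = A_j(Y)`, §L). -/
theorem levelFinite_T (j : ℤ) : LevelFinite (T j) := levelFinite_of_domSuper (domSuper_T j)
/-- **`∀ j m₀, ThinFibreAt m₀ (T j)`** — in particular AT THE RESIDUAL QUALITY `m₀ = 2`, hypothesis-free. -/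
theorem thinFibreAt_T (j : ℤ) (m₀ : ℕ) : ThinFibreAt m₀ (T j) := thinFibreAt_of_domSuper (domSuper_T j) m₀
/-- `(j : ℤ) : BddLevelEmpty (T j)`. -/
theorem bddLevelEmpty_T (j : ℤ) : BddLevelEmpty (T j) := bddLevelEmpty_of_domSuper (domSuper_T j)
/-- `(j : ℤ) : SiegelClause (T j)` (disjunct (A)). -/
theorem siegelClause_T (j : ℤ) : SiegelClause (T j) := siegelClause_of_domSuper (domSuper_T j)
/-- `(j : ℤ)` : all but finitely many levels of `T j` carry no rational point at all. -/
theorem finite_pointed_levels_T (j : ℤ) : {N : ℕ | ∃ r : ℚ, bev (T j) (partialSum 2 N) r = 0}.Finite :=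
  finite_pointed_levels_of_domSuper (domSuper_T j)
/-- `(j : ℤ)` : finitely many rational points of `T j` with dyadic abscissa. -/
theorem finite_dyadicPoints_T (j : ℤ) : {p : ℚ × ℚ | IsDyadic p.1 ∧ bev (T j) p.1 p.2 = 0}.Finite :=
  finite_dyadicPoints_of_domSuper (domSuper_T j)
/-- `(j : ℤ)` : finitely many level ORDINATES of `T j`. -/
theorem finite_ordinates_T (j : ℤ) : {r : ℚ | ∃ N : ℕ, bev (T j) (partialSum 2 N) r = 0}.Finite :=
  (finite_ordinates_lac 3 (tC j) le_rfl (tC_lac j) (domZero_tC j) (separable_tC_zero j) (two_le_natDegree_tC_zero j)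
    (isCoprime_tC j)).subset fun r ⟨N, h⟩ => ⟨sQ N, isDyadic_sQ N, by rwa [T, sQ_cast] at *⟩

end Family

end Summit.Schanuel.Schanuel.Theorems.RootDecomp1KSuperellipticSiegel

end
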